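import Summits.BirchSwinnertonDyer.Rank1Residual.AdditivePotMult.PotMultChiBranchPrime
import Literature.NumberTheory.EllipticCurves.Wuthrich2014.ReducibleDivisibilityCyclotomicThreeMinus
import Literature.NumberTheory.EllipticCurves.Wuthrich2014.SurjectiveDivisibilityCyclotomicThreeMinus
import HarnessLib

/-!
# The `p = 3` component readings A122 / A123 FOLLOW from the general-`p` semistable component readings
# (kernel derivation asked for by the literature seat, ruling C169; NO named fact in this file)
# (cell `b2b-bsdres`, seat additive-p1, gen 9)

HONEST FRAMING (cell `b2b-bsdres`, run/shared/lean/b2b/bsd-rank1-residual/, verbatim in every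
file): the goal of the cell is to DELETE the COMBINATION-SHAPED residual classes of the
Birch–Swinnerton-Dyer formula for ALL analytic-rank `≤ 1` elliptic curves over `ℚ` — "full BSD
formula for every rank `≤ 1` curve in class `C`" assembled STRICTLY from published theorems — so
that the rank-`≤ 1` remainder becomes exactly the CONSTRUCTION-SHAPED classes, which are TYPED
(missing-input `Prop`s), NOT attempted. This is not "finishing BSD". Sub-cell additive-p1
(X3♯(M) / X4(M)); labels UNCHANGED by this file; nothing is booked.

Theorems + one conversion `def` (`EigenSelmerDualData.toChiEigen`, field-for-field, same carrier).
The `ω`-component readings at `p = 3` — `Wuthrich2014.thm16_minusEigenCharIdeal_dvd_cyclotomicThree`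
(A122) and `Wuthrich2014.kato_minusEigenCharIdeal_dvd_cyclotomicThree_of_surjective` (A123), stated over
`K·ℚ_∞ = ℚ(μ_{3^∞})` for `K = ℚ(ζ₃)` with `H = ker κ ⊓ galRange K` — are the special case `p = 3`,
`F = K` of the general-`p` semistable component readings
`Wuthrich2014.thm16_halfEigenCharIdeal_dvd_cyclotomicPrime` (p235418) /
`Wuthrich2014.kato_halfEigenCharIdeal_dvd_cyclotomicPrime_of_surjective` (p235488), stated over
`F·K·ℚ_∞` with `H = ker κ ⊓ galRange K ⊓ galRange F`. The two `H`'s differ only formally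
(`galRange K ⊓ galRange K`); the bridge is additive-p2's eigen-descent `ChiEigenSelmerDualData.toIn`
(`Additive/ChiEigenPrimeToPDescentDual.lean`; here of index `1`) sandwiched between the `rfl`-level
repackagings `EigenSelmerDualData.toChiEigen` (this file) and `ChiEigenSelmerInDualData.toEigen`
(`PotMultChiBranchPrime.lean`), all with the SAME underlying `Λ`-module. Hence
`thm16_minusEigenCharIdeal_dvd_cyclotomicThree_of_half : A-general ⟹ A122` and
`kato_minusEigenCharIdeal_dvd_cyclotomicThree_of_surjective_of_half : A-general ⟹ A123` — giving the
referee the option of retiring A122/A123 (and, with the Literature corollaries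
`…ComponentOfHalf.lean`, A124/A125) by migrating consumers to the two general facts. No new assertion
(debt 0).

References: Wuthrich 2014 [Wuthrich2014] §3 p. 390, Thm. 16, Cor. 19; Kato 2004 [Kato2004Asterisque]
Thm. 17.4; Greenberg LNM 1716 [GreenbergLNM1716] §5 p. 143.
-/

noncomputable section

open scoped Classical MatrixGroups ModularForm

namespace Summit.BirchSwinnertonDyer.Rank1Residual.AdditivePotMult

open CongruenceSubgroup WeierstrassCurve Literature.NumberTheory.EllipticCurves
  Literature.NumberTheory.EllipticCurves.ModularForms
  Literature.NumberTheory.EllipticCurves.Rank1Residual Literature.NumberTheory.GaloisRepresentations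
  Additive

/-! ## §1 The inverse repackaging: a Literature eigen datum at `(ker κ ⊓ galRange K, ker κ, χ_K)` IS a `ChiEigenSelmerDualData` -/

section OfEigen

variable (V : WeierstrassCurve ℚ) (K : Type) [Field K] [NumberField K] {p : ℕ} [Fact p.Prime]
  (κ : ZpExtension ℚ p) [(galRange (K := ℚ) K).Normal] (γ : Field.absoluteGaloisGroup ℚ)

/-- A Literature `EigenSelmerDualData` at `(ker κ ⊓ Gal(ℚ̄/K), ker κ, χ_K)` IS a
`ChiEigenSelmerDualData V K κ γ` (same carrier; inverse of `ChiEigenSelmerDualData.toEigen`).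
[folklore] -/
def EigenSelmerDualData.toChiEigen
    (D : V.EigenSelmerDualData p (κ.kerSubgroup ⊓ galRange (K := ℚ) K) κ.kerSubgroup
      (fun g ↦ if g ∈ galRange (K := ℚ) K then 1 else -1) γ) :
    ChiEigenSelmerDualData V K κ γ where
  X := D.X
  toDual := D.toDual
  bijective := D.bijective
  toDual_T_smul := D.toDual_T_smul
  toDual_C_smul := D.toDual_C_smul

/-- Same module. [folklore] -/
theorem EigenSelmerDualData.toChiEigen_X
    (D : V.EigenSelmerDualData p (κ.kerSubgroup ⊓ galRange (K := ℚ) K) κ.kerSubgroup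
      (fun g ↦ if g ∈ galRange (K := ℚ) K then 1 else -1) γ) :
    (EigenSelmerDualData.toChiEigen V K κ γ D).X = D.X :=
  rfl

end OfEigen

/-! ## §2 A122 / A123 from the general-`p` readings at `p = 3`, `F = K = ℚ(ζ₃)` -/

section Three

/-- Bookkeeping at `p = 3`: `(−1)^{3/2}·3 = −3`, `3/2 = 1`, `¬ Even (3/2)`. [folklore] -/
theorem pStar_three : ((-1 : ℚ) ^ (3 / 2) * (3 : ℕ)) = -((3 : ℕ) : ℚ) := by norm_num

/-- **A122 from the general semistable component reading.** At `p = 3` with `F = K = ℚ(ζ₃)`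
(`IsCyclotomicExtension {3} ℚ K`; `[K:ℚ] = 2`, `√−3 = 2ζ₃ + 1 ∈ K`): a datum
`D : V.EigenSelmerDualData 3 (ker κ ⊓ galRange K) (ker κ) χ_K γ` (A122's slot) is carried — same
module — to the `F`-level slot `(ker κ ⊓ galRange K ⊓ galRange K, ker κ, χ_K)` of the general fact by
`toChiEigen` ∘ additive-p2's `ChiEigenSelmerDualData.toIn` (index-`1` eigen-descent) ∘
`ChiEigenSelmerInDualData.toEigen`; the general fact's three disjuncts at `p = 3` (`3/2 = 1`, odd) are
A122's three `Lminus` disjuncts. [cite: Wuthrich2014, Thm. 16 (p. 397) and §3 (p. 390)] -/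
theorem thm16_minusEigenCharIdeal_dvd_cyclotomicThree_of_half
    (h : Wuthrich2014.thm16_halfEigenCharIdeal_dvd_cyclotomicPrime) :
    Wuthrich2014.thm16_minusEigenCharIdeal_dvd_cyclotomicThree := by
  intro V _ _ K _ _ _ _ κ γ N _ f Lminus hL hred hκ hγ hcyc hγK hf D ϖ' hϖ'
  have h2 := Literature.NumberTheory.GaloisRepresentations.finrank_eq_two_of_isCyclotomicExtension_three
    (K := K)
  obtain ⟨θ, hθ, hθ2⟩ := exists_sq_eq_neg_three_of_isCyclotomicExtension_three K
  have hcop : (galRange (K := ℚ) K).index.Coprime 3 := coprime_index_galRange K h2 hθ hθ2 3 (by norm_num)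
  -- the `F`-level datum with the same module (`F = K`)
  let D' : V.EigenSelmerDualData 3
      (κ.kerSubgroup ⊓ galRange (K := ℚ) K ⊓ galRange (K := ℚ) K) κ.kerSubgroup
      (fun g ↦ if g ∈ galRange (K := ℚ) K then 1 else -1) γ :=
    ChiEigenSelmerInDualData.toEigen V K κ _ γ
      (ChiEigenSelmerDualData.toIn V K κ (galRange (K := ℚ) K) γ (isOpen_galRange K) hcop
        (EigenSelmerDualData.toChiEigen V K κ γ D))
  have hB : (IsOrdinaryAt V 3 ∧
        Lminus = if Even (3 / 2) then padicLFunctionBranch f ((unitRoot V 3 : ℤ_[3]) : ℚ_[3]) (3 / 2)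
          else padicLFunctionMinusBranch f ((unitRoot V 3 : ℤ_[3]) : ℚ_[3]) (3 / 2)) ∨
      (V.HasSplitMultiplicativeReductionAtPrime 3 ∧
        Lminus = if Even (3 / 2) then padicLFunctionPlusBranchMult f (1 : ℚ_[3]) (3 / 2)
          else padicLFunctionMinusBranchMult f (1 : ℚ_[3]) (3 / 2)) ∨
      (V.HasMultiplicativeReductionAtPrime 3 ∧ ¬ V.HasSplitMultiplicativeReductionAtPrime 3 ∧
        Lminus = if Even (3 / 2) then padicLFunctionPlusBranchMult f (-1 : ℚ_[3]) (3 / 2)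
          else padicLFunctionMinusBranchMult f (-1 : ℚ_[3]) (3 / 2)) := by
    have h32 : (3 / 2 : ℕ) = 1 := rfl
    have hodd : ¬ Even (3 / 2) := by decide
    simp only [if_neg hodd, h32]
    exact hL
  exact h 3 V K K Lminus (by norm_num) h2 ⟨θ, by rw [pStar_three]; exact hθ2⟩ hB hred hκ hγ hcyc hγK
    hγK hf D' ϖ' (by rw [if_neg (by decide)]; exact hϖ')

/-- **A123 from the general semistable big-image component reading** (same transport; image
hypothesis `∀ n, Surj V (3^n)`). [cite: Wuthrich2014, Thm. 3 (p. 383) and Cor. 19 (p. 398)]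
[cite: Kato2004Asterisque, Thm. 17.4 (3) (p. 273)] -/
theorem kato_minusEigenCharIdeal_dvd_cyclotomicThree_of_surjective_of_half
    (h : Wuthrich2014.kato_halfEigenCharIdeal_dvd_cyclotomicPrime_of_surjective) :
    Wuthrich2014.kato_minusEigenCharIdeal_dvd_cyclotomicThree_of_surjective := by
  intro V _ _ K _ _ _ _ κ γ N _ f Lminus hL hsurj hκ hγ hcyc hγK hf D ϖ' hϖ'
  have h2 := Literature.NumberTheory.GaloisRepresentations.finrank_eq_two_of_isCyclotomicExtension_three
    (K := K)
  obtain ⟨θ, hθ, hθ2⟩ := exists_sq_eq_neg_three_of_isCyclotomicExtension_three K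
  have hcop : (galRange (K := ℚ) K).index.Coprime 3 := coprime_index_galRange K h2 hθ hθ2 3 (by norm_num)
  let D' : V.EigenSelmerDualData 3
      (κ.kerSubgroup ⊓ galRange (K := ℚ) K ⊓ galRange (K := ℚ) K) κ.kerSubgroup
      (fun g ↦ if g ∈ galRange (K := ℚ) K then 1 else -1) γ :=
    ChiEigenSelmerInDualData.toEigen V K κ _ γ
      (ChiEigenSelmerDualData.toIn V K κ (galRange (K := ℚ) K) γ (isOpen_galRange K) hcop
        (EigenSelmerDualData.toChiEigen V K κ γ D))
  have hB : (IsOrdinaryAt V 3 ∧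
        Lminus = if Even (3 / 2) then padicLFunctionBranch f ((unitRoot V 3 : ℤ_[3]) : ℚ_[3]) (3 / 2)
          else padicLFunctionMinusBranch f ((unitRoot V 3 : ℤ_[3]) : ℚ_[3]) (3 / 2)) ∨
      (V.HasSplitMultiplicativeReductionAtPrime 3 ∧
        Lminus = if Even (3 / 2) then padicLFunctionPlusBranchMult f (1 : ℚ_[3]) (3 / 2)
          else padicLFunctionMinusBranchMult f (1 : ℚ_[3]) (3 / 2)) ∨
      (V.HasMultiplicativeReductionAtPrime 3 ∧ ¬ V.HasSplitMultiplicativeReductionAtPrime 3 ∧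
        Lminus = if Even (3 / 2) then padicLFunctionPlusBranchMult f (-1 : ℚ_[3]) (3 / 2)
          else padicLFunctionMinusBranchMult f (-1 : ℚ_[3]) (3 / 2)) := by
    have h32 : (3 / 2 : ℕ) = 1 := rfl
    have hodd : ¬ Even (3 / 2) := by decide
    simp only [if_neg hodd, h32]
    exact hL
  exact h 3 V K K Lminus (by norm_num) h2 ⟨θ, by rw [pStar_three]; exact hθ2⟩ hB hsurj hκ hγ hcyc
    hγK hγK hf D' ϖ' (by rw [if_neg (by decide)]; exact hϖ')

end Three

end Summit.BirchSwinnertonDyer.Rank1Residual.AdditivePotMult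

end
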